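import Literature.AlgebraicGeometry.Resolution.RegularLocalOrder
import Mathlib.RingTheory.Ideal.Colon
import HarnessLib

/-!
# [OURS · L1 W4.6 rung (i-a), local brick] Dividing an ideal of order `c` by the `b`-th power of a regular parameter
# leaves order at least `c - b` (regular local rings)
# (cell res-hironaka, LADDER-RESOLUTION rung L, D-0089; campaign s46, prover res-L1-s46-pv-1; host route
# MarkedTransfer, `--supports stmt-ResolutionOfSingularities-16155`)

HONEST FRAMING. Nothing here is a statement of H. Hironaka's manuscript (2017-03-23, [Hironaka2017]). Elementary
commutative algebra over the tree's order additivity in regular local rings (`RegularLocalOrder.lean`,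
Zariski–Samuel VIII §1 Thm. 1): the local brick behind the «window» step of rung (i-a) (plan in
L/res-L1-s46-pv-1/NOTES.md): at a point `x′` of the exceptional divisor `{t = 0}` (a regular parameter, `t ∉ 𝔪²`)
the controlled transform `(J𝒪 : t^b)` of an ideal with `J𝒪 ⊆ 𝔪^c` has order `≥ c - b`; at the generic point of
the exceptional curve this gives `ord ≥ ord_x J - b`, whence `ord_x J < 2b` at every blown-up point of a regime with
isolated singular locus. AI review is weaker than expert review. No `sorry`; axioms standard.

## Contents

* `mul_pow_mem_pow_imp` — `a · t^b ∈ 𝔪^c`, `t ∉ 𝔪²` ⟹ `a ∈ 𝔪^(c-b)`.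
* `colon_span_pow_le_pow` — `(I : t^b) ⊆ 𝔪^(c-b)` for `I ⊆ 𝔪^c` (set-colon by `(t)^b`, the form of the stalk of a
  controlled transform, tree `stalkIdeal_colon_of_isEffectiveCartier_pow`).
-/

set_option linter.dupNamespace false -- mandated namespace of this single-conjunct summit

namespace Summit.ResolutionOfSingularities.ResolutionOfSingularities.Theorems

namespace CampaignW46

open IsLocalRing Literature.AlgebraicGeometry.Resolution

universe u

variable {R : Type u} [CommRing R] [IsRegularLocalRing R]

/-- **Order bookkeeping for division by a regular parameter** (regular local ring): if `t ∉ 𝔪²` and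
`a · t^b ∈ 𝔪^c` then `a ∈ 𝔪^(c - b)` (`ord(a t^b) = ord a + b`). [cite: ZariskiSamuel1960, Ch. VIII §1 Thm. 1] -/
theorem mul_pow_mem_pow_imp {t a : R} (ht : t ∉ maximalIdeal R ^ 2) {b c : ℕ}
    (h : a * t ^ b ∈ maximalIdeal R ^ c) : a ∈ maximalIdeal R ^ (c - b) := by
  by_contra ha
  -- `c - b = k + 1` with `a ∉ 𝔪^(k+1)` and `t^b ∉ 𝔪^(b+1)`
  obtain ⟨k, hk⟩ : ∃ k, c - b = k + 1 := by
    rcases Nat.eq_zero_or_pos (c - b) with h0 | hpos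
    · rw [h0, pow_zero, Ideal.one_eq_top] at ha
      exact absurd Submodule.mem_top ha
    · exact ⟨c - b - 1, by omega⟩
  rw [hk] at ha
  have htb : t ^ b ∉ maximalIdeal R ^ (b * 1 + 1) := pow_not_mem_pow_of_not_mem_pow (p := 1) ht b
  have hprod := mul_not_mem_pow_of_not_mem_pow ha htb
  -- `k + b·1 + 1 = c` up to `≤`
  exact hprod (Ideal.pow_le_pow_right (by omega) h)

/-- **`(I : t^b) ⊆ 𝔪^(c-b)` for `I ⊆ 𝔪^c`** and a regular parameter `t ∉ 𝔪²` (the set-colon by the ideal `(t)^b`).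
[cite: ZariskiSamuel1960, Ch. VIII §1 Thm. 1] -/
theorem colon_span_pow_le_pow {t : R} (ht : t ∉ maximalIdeal R ^ 2) {I : Ideal R} {b c : ℕ}
    (hI : I ≤ maximalIdeal R ^ c) :
    Submodule.colon I ((Ideal.span {t} ^ b : Ideal R) : Set R) ≤ maximalIdeal R ^ (c - b) := by
  intro a ha
  rw [Submodule.mem_colon] at ha
  have h : a * t ^ b ∈ I := by
    have := ha (t ^ b) (by
      rw [Ideal.span_singleton_pow, SetLike.mem_coe]
      exact Ideal.mem_span_singleton_self _)
    simpa [smul_eq_mul] using this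
  exact mul_pow_mem_pow_imp ht (hI h)

end CampaignW46

end Summit.ResolutionOfSingularities.ResolutionOfSingularities.Theorems
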